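import Summits.NavierStokesRegularity.NavierStokesRegularity.Theorems.LerayQuarterDissipationFiniteDissipationLiouvilleTraceHalfSpace
import Summits.NavierStokesRegularity.NavierStokesRegularity.Theorems.LerayQuarterDissipationFiniteDissipationLiouvilleQuietVorticity
import Literature.Analysis.FluidPDE.ESSFarFieldVorticityHalfSpaceTopCurl
import Literature.Analysis.FluidPDE.GKPRigidityFarField
import HarnessLib

/-!
# Crux `FiniteDissipationLiouville` (stmt-NavierStokesRegularity-22144): tools for the
# ROTATIONAL-TRACE leaf — far-field regularity through the apex with derivative bounds, and the
# vanishing of the far-field vorticity when the trace is irrotational on a half-space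

Theorems file of route `LerayQuarterDissipation` (lead prover g6; `--supports` the crux; file 1/2
of the rotational-trace leaf, portrait fact for the registered stub `stub_envelopeCriticalLiouville`
of skeleton v9). Navier–Stokes regularity is NOT proved by anything here; no summit is.

`𝒟_{C,K}`: Type-I ancient mild fields `u` (`IsTypeIAncientMild C u`) with the quarter-rate law;
`T_u(ψ) = lim_{t→0⁻} ∫⟪u(t), ψ⟫` the distributional trace at the singular time (lead g3).

* `exists_farField_derivBounds` — **FAR-FIELD REGULARITY THROUGH THE SINGULAR TIME WITH BOUNDS**:
  for `u ∈ 𝒟_{C,K}` there are `R₀, K'` with `‖D_xⁿu(t,x)‖ ≤ K'` (`n ≤ 4`) on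
  `(-1, 0) × {‖x‖ > R₀}`, and jointly continuous `(t,x) ↦ D_xⁿu(t,x)` there. The shifted field is a
  local Leray solution on `(0,2) × ℝ³` (lead g3, `exists_isLocalLeraySolutionOn_shift`), bounded on
  the far field (`farField_bound_anyDatum`), whence a far-field representative with bounds
  (`exists_farField_representative_unit`, Lemarié-Rieusset Thm. 15.4 Step 2); the bounds transfer
  to the smooth field (`iteratedFDeriv_slice_eq_of_ae_eq_of_continuousOn`).
* `exists_farField_curl_eq_zero_of_trace_irrotational` — **if the trace is IRROTATIONAL on the
  half-space `{⟪x, e⟫ > R₁}`** (`∫⟪u(t), ∇ ∧ ψ⟫ → 0` for the test fields `ψ` supported there),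
  **then `∇ ∧ u(t, ·) = 0` on a farther half-space for every `t ∈ (-1, 0)`**: the classical
  solution is a distributional one on the far region; the vorticity pairings at the top are
  velocity pairings against `∇ ∧ (σφ)` (`σ` a smooth half-space step; the curl is self-adjoint),
  so the cut-off vorticity `σ ∇ ∧ u` tends to `0` weakly at the top; then the vorticity-top form of
  Escauriaza–Seregin–Šverák's far-field step (`farField_curl_eq_zero_halfSpace_of_vorticity_top`,
  this lead, Literature).
* tools: `inner_le_norm_of_unit`, `exists_halfSpace_cutoff`, `slice_eq_zero_of_curl_eq_zero_near`
  (an analytic slice irrotational near one point vanishes: identity theorem + `QuietVorticity`).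

References: Escauriaza–Seregin–Šverák, Russ. Math. Surveys 58 (2003), §3, Thm. 5.1;
Lemarié-Rieusset (2016), Thm. 15.4, Step 2; Koch–Nadirashvili–Seregin–Šverák, Acta Math. 203
(2009), §4.
-/
noncomputable section

-- the summit and its single sub-problem share the name (CONVENTIONS §1), as in every Theorems file
set_option linter.dupNamespace false

namespace Summit.NavierStokesRegularity.NavierStokesRegularity.Theorems.FiniteDissipationLiouville.Birth.Apex

open MeasureTheory Set Filter Topology Metric Function TopologicalSpace
open Literature.Analysis Literature.Analysis.FluidPDE
open scoped ENNReal NNReal RealInnerProductSpace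

variable {C K : ℝ} {u : ℝ → EuclideanSpace ℝ (Fin 3) → EuclideanSpace ℝ (Fin 3)}

/-! ### Tools -/

/-- `⟪x, e⟫ ≤ ‖x‖` for a unit vector `e`. -/
theorem inner_le_norm_of_unit {e : EuclideanSpace ℝ (Fin 3)} (he : ‖e‖ = 1)
    (x : EuclideanSpace ℝ (Fin 3)) : ⟪x, e⟫ ≤ ‖x‖ := by
  have h := real_inner_le_norm x e
  rwa [he, mul_one] at h

/-- **A smooth step across the plane `{⟪x, e⟫ = R}`**: `σ` is `C^∞`, equal to `1` on `{⟪x, e⟫ ≥ R}`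
and to `0` on `{⟪x, e⟫ ≤ R − 1/2}`; for a test field `φ`, `σ • φ` is a test field
(`Real.smoothTransition`; twin of the private tool of `LocalLerayBackwardUniquenessHalfSpace`). -/
theorem exists_halfSpace_cutoff (e : EuclideanSpace ℝ (Fin 3)) (R : ℝ) :
    ∃ σ : EuclideanSpace ℝ (Fin 3) → ℝ, ContDiff ℝ (⊤ : ℕ∞) σ ∧
      (∀ x : EuclideanSpace ℝ (Fin 3), R ≤ ⟪x, e⟫ → σ x = 1) ∧
      (∀ x : EuclideanSpace ℝ (Fin 3), σ x ≠ 0 → R - 1 / 2 < ⟪x, e⟫) ∧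
      ∀ φ : EuclideanSpace ℝ (Fin 3) → EuclideanSpace ℝ (Fin 3),
        FunctionSpaces.IsTestFunctionOn (⊤ : Opens (EuclideanSpace ℝ (Fin 3))) φ →
        FunctionSpaces.IsTestFunctionOn (⊤ : Opens (EuclideanSpace ℝ (Fin 3))) (fun x => σ x • φ x) := by
  have h1 : ContDiff ℝ (⊤ : ℕ∞) (fun x : EuclideanSpace ℝ (Fin 3) => 2 * (⟪x, e⟫ - R) + 1) :=
    (contDiff_const.mul ((contDiff_id.inner ℝ contDiff_const).sub contDiff_const)).add
      contDiff_const
  have hσ : ContDiff ℝ (⊤ : ℕ∞)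
      (fun x : EuclideanSpace ℝ (Fin 3) => Real.smoothTransition (2 * (⟪x, e⟫ - R) + 1)) :=
    Real.smoothTransition.contDiff.comp h1
  refine ⟨fun x => Real.smoothTransition (2 * (⟪x, e⟫ - R) + 1), hσ, ?_, ?_, ?_⟩
  · intro x hx
    exact Real.smoothTransition.one_of_one_le (by linarith)
  · intro x hx
    by_contra hle
    push Not at hle
    exact hx (Real.smoothTransition.zero_of_nonpos (by linarith))
  · intro φ hφ
    exact ⟨hσ.smul hφ.contDiff, hφ.hasCompactSupport.mono fun x hx => right_ne_zero_of_smul hx,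
      fun y _ => Opens.mem_top y⟩

/-- **An analytic slice of a member of `𝒟_{C,K}` irrotational NEAR ONE POINT vanishes
identically** (identity theorem for the analytic vorticity, then `−Δ = curl curl` and the harmonic
Liouville theorem in `L⁶`; `QuietVorticity.slice_eq_zero_of_curl_eq_zero_on_ball` is the case
`x₀ = 0`). [cite: LemarieRieusset2016, Thm. 9.12 (PDF p. 260)] -/
theorem slice_eq_zero_of_curl_eq_zero_near (hu : IsTypeIAncientMild C u)
    (hlaw : ∀ s : ℝ, s < 0 → ∫⁻ x, ‖fderiv ℝ (u s) x‖ₑ ^ 2 ≤ ENNReal.ofReal (K / Real.sqrt (-s)))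
    {s : ℝ} (hs : s < 0) {x₀ : EuclideanSpace ℝ (Fin 3)} {r : ℝ} (hr : 0 < r)
    (h0 : ∀ x ∈ ball x₀ r, curl (u s) x = 0) : ∀ x, u s x = 0 := by
  have han : AnalyticOnNhd ℝ (u s) univ := hu.analyticOnNhd_slice_univ hs
  have hanC : AnalyticOnNhd ℝ (curl (u s)) univ := by
    rw [curl_eq_curlCLM_comp]
    exact (curlCLM).comp_analyticOnNhd han.fderiv
  have hev : curl (u s) =ᶠ[𝓝 x₀] fun _ => (0 : EuclideanSpace ℝ (Fin 3)) :=
    eventuallyEq_of_mem (ball_mem_nhds x₀ hr) fun x hx => h0 x hx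
  have hC0 : ∀ x, curl (u s) x = 0 := fun x =>
    AnalyticOnNhd.eqOn_of_preconnected_of_eventuallyEq hanC analyticOnNhd_const
      (convex_univ.isPreconnected) (mem_univ x₀) hev (mem_univ x)
  exact QuietVorticity.slice_eq_zero_of_curl_eq_zero hu hlaw hs hC0

/-! ### Far-field regularity through the singular time, with derivative bounds -/

/-- **FAR-FIELD REGULARITY THROUGH THE APEX WITH BOUNDS.** For a member `u ∈ 𝒟_{C,K}` there are
`R₀` and `K'` such that `‖D_xⁿu(t, x)‖ ≤ K'` for `n ≤ 4`, `t ∈ (-1, 0)`, `‖x‖ > R₀`, and the maps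
`(t, x) ↦ D_xⁿu(t, x)` are jointly continuous there (all `n`). Proof: the shifted field
`t ↦ u(t − 2)` is a local Leray solution on `(0, 2) × ℝ³` (lead g3); far-field bound
(`farField_bound_anyDatum`), far-field representative with bounds (`exists_farField_representative_unit`,
Lemarié-Rieusset Thm. 15.4, Step 2), transfer to the smooth field
(`iteratedFDeriv_slice_eq_of_ae_eq_of_continuousOn`), shift back.
[cite: LemarieRieusset2016, proof of Thm. 15.4, Step 2 (PDF p. 569)] -/
theorem exists_farField_derivBounds (hu : IsTypeIAncientMild C u)
    (hlaw : ∀ s : ℝ, s < 0 → ∫⁻ x, ‖fderiv ℝ (u s) x‖ₑ ^ 2 ≤ ENNReal.ofReal (K / Real.sqrt (-s))) :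
    ∃ R₀ K' : ℝ, (∀ n ≤ 4, ∀ t ∈ Ioo (-1 : ℝ) 0, ∀ x : EuclideanSpace ℝ (Fin 3), R₀ < ‖x‖ →
        ‖iteratedFDeriv ℝ n (u t) x‖ ≤ K') ∧
      ∀ n : ℕ, ContinuousOn (fun z : ℝ × EuclideanSpace ℝ (Fin 3) => iteratedFDeriv ℝ n (u z.1) z.2)
        (Ioo (-1 : ℝ) 0 ×ˢ {x : EuclideanSpace ℝ (Fin 3) | R₀ < ‖x‖}) := by
  -- the shifted local Leray solution on `(0, 2)`
  obtain ⟨π, hLL⟩ := exists_isLocalLeraySolutionOn_shift hu hlaw (T := 2) two_pos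
  have hdiv : IsWeaklyDivFree (u (-2)) := hu.isWeaklyDivFree (by norm_num)
  obtain ⟨R₁, hbd⟩ := hLL.farField_bound_anyDatum one_pos (t₁ := 1 / 2) (t₂ := 2) (by norm_num) le_rfl
  obtain ⟨K', U, hae, hUc, -, hjc, hbdK⟩ := exists_farField_representative_unit
    NSBoundedHigherRegularityBounds_holds kangMiuraTsai_local_pressure_bound_holds hdiv hLL
    (t₁ := 1 / 2) (t₂ := 2) (R₀ := R₁) (by norm_num) le_rfl hbd (T₄ := 1) (R := R₁ + 1)
    (by norm_num) (by norm_num) (by linarith) 4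
  set Ω : Set (ℝ × EuclideanSpace ℝ (Fin 3)) :=
    Ioo (1 : ℝ) 2 ×ˢ (closedBall (0 : EuclideanSpace ℝ (Fin 3)) (R₁ + 1))ᶜ with hΩdef
  have hΩo : IsOpen Ω := isOpen_Ioo.prod isClosed_closedBall.isOpen_compl
  have hΩS : Ω ⊆ Iio (2 : ℝ) ×ˢ univ := prod_mono (fun t ht => ht.2) (subset_univ _)
  -- the shifted field is jointly smooth on `(-∞, 2) × ℝ³`
  have hsm : IsSmoothSpaceTimeOn (Iio (2 : ℝ)) (fun t => u (t - 2)) := by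
    have h1 : ContDiff ℝ (⊤ : ℕ∞) fun z : ℝ × EuclideanSpace ℝ (Fin 3) => (z.1 - 2, z.2) := by
      fun_prop
    have hmaps : MapsTo (fun z : ℝ × EuclideanSpace ℝ (Fin 3) => (z.1 - 2, z.2))
        (Iio (2 : ℝ) ×ˢ univ) (Iio 0 ×ˢ univ) := fun z hz =>
      ⟨by have := (mem_prod.1 hz).1; show z.1 - 2 < 0; simpa [mem_Iio, sub_neg] using this,
        mem_univ _⟩
    exact hu.1.comp h1.contDiffOn hmaps
  -- transfer of the derivatives to the smooth field
  have htrans : ∀ n : ℕ, ∀ w ∈ Ω,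
      iteratedFDeriv ℝ n (u (w.1 - 2)) w.2 = iteratedFDeriv ℝ n (U w.1) w.2 := fun n w hw =>
    iteratedFDeriv_slice_eq_of_ae_eq_of_continuousOn hsm hΩo hΩS hUc hae n hw
  -- the membership of the shifted point
  have hmem : ∀ t ∈ Ioo (-1 : ℝ) 0, ∀ x : EuclideanSpace ℝ (Fin 3), R₁ + 1 < ‖x‖ →
      ((t + 2, x) : ℝ × EuclideanSpace ℝ (Fin 3)) ∈ Ω := fun t ht x hx =>
    ⟨⟨by linarith [ht.1], by linarith [ht.2]⟩, by
      rw [mem_compl_iff, mem_closedBall, dist_zero_right, not_le]; exact hx⟩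
  refine ⟨R₁ + 1, K', fun n hn t ht x hx => ?_, fun n => ?_⟩
  · have h := htrans n (t + 2, x) (hmem t ht x hx)
    simp only [add_sub_cancel_right] at h
    rw [h]
    exact hbdK n hn (t + 2, x) (hmem t ht x hx)
  · -- joint continuity: compose with the shift and use `EqOn`
    have hsh : Continuous fun z : ℝ × EuclideanSpace ℝ (Fin 3) => ((z.1 + 2, z.2) : ℝ × _) := by
      fun_prop
    have hmaps : MapsTo (fun z : ℝ × EuclideanSpace ℝ (Fin 3) => ((z.1 + 2, z.2) : ℝ × _))
        (Ioo (-1 : ℝ) 0 ×ˢ {x : EuclideanSpace ℝ (Fin 3) | R₁ + 1 < ‖x‖}) Ω := fun z hz =>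
      hmem z.1 hz.1 z.2 hz.2
    have hcomp : ContinuousOn
        (fun z : ℝ × EuclideanSpace ℝ (Fin 3) => iteratedFDeriv ℝ n (U (z.1 + 2)) z.2)
        (Ioo (-1 : ℝ) 0 ×ˢ {x : EuclideanSpace ℝ (Fin 3) | R₁ + 1 < ‖x‖}) :=
      (hjc n).comp hsh.continuousOn hmaps
    refine hcomp.congr fun z hz => ?_
    have h := htrans n (z.1 + 2, z.2) (hmaps hz)
    simp only [add_sub_cancel_right] at h
    exact h

/-! ### The far-field vorticity vanishes when the trace is irrotational on a half-space -/

/-- **The far-field vorticity of a member whose trace is irrotational on `{⟪x, e⟫ > R₁}` vanishes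
on a farther half-space for `t ∈ (-1, 0)`** (ESŠ 2003 Thm. 5.1 via
`farField_curl_eq_zero_halfSpace_of_vorticity_top`; the classical solution is a distributional
one on the far region; the vorticity pairings at the top are velocity pairings against
`∇ ∧ (σφ)`). [cite: EscauriazaSereginSverak2003, §3 (3.31)-(3.32) and Thm. 5.1] -/
theorem exists_farField_curl_eq_zero_of_trace_irrotational (hu : IsTypeIAncientMild C u)
    (hlaw : ∀ s : ℝ, s < 0 → ∫⁻ x, ‖fderiv ℝ (u s) x‖ₑ ^ 2 ≤ ENNReal.ofReal (K / Real.sqrt (-s)))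
    {e : EuclideanSpace ℝ (Fin 3)} (he : ‖e‖ = 1) {R₁ : ℝ}
    (hirr : ∀ ψ : EuclideanSpace ℝ (Fin 3) → EuclideanSpace ℝ (Fin 3),
      FunctionSpaces.IsTestFunctionOn (⊤ : Opens (EuclideanSpace ℝ (Fin 3))) ψ →
        (∀ x, ψ x ≠ 0 → R₁ < ⟪x, e⟫) →
        Tendsto (fun t => ∫ x, ⟪u t x, curl ψ x⟫) (𝓝[<] 0) (𝓝 0)) :
    ∃ R : ℝ, ∀ t ∈ Ioo (-1 : ℝ) 0, ∀ x : EuclideanSpace ℝ (Fin 3), R < ⟪x, e⟫ → curl (u t) x = 0 := by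
  obtain ⟨R₀, K', hbd, hjc⟩ := exists_farField_derivBounds hu hlaw
  -- the half-space `{⟪x, e⟫ > R}`, `R ≥ R₀ + 1`, `R - 1/2 ≥ R₁`
  set R : ℝ := max R₀ R₁ + 1 with hRdef
  have hRR₁ : R₁ ≤ R - 1 / 2 := by rw [hRdef]; linarith [le_max_right R₀ R₁]
  set I : Set ℝ := Ioo (-1 : ℝ) 0 with hIdef
  set S : Set (EuclideanSpace ℝ (Fin 3)) := {x : EuclideanSpace ℝ (Fin 3) | R < ⟪x, e⟫} with hSdef
  have hIo : IsOpen I := isOpen_Ioo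
  have hSo : IsOpen S := isOpen_lt continuous_const (continuous_id.inner continuous_const)
  set Ω : Set (ℝ × EuclideanSpace ℝ (Fin 3)) := I ×ˢ S with hΩdef
  have hΩo : IsOpen Ω := hIo.prod hSo
  have hSfar : ∀ x ∈ S, R₀ < ‖x‖ := fun x hx => by
    have hx' : R < ⟪x, e⟫ := hx
    have := inner_le_norm_of_unit he x
    rw [hRdef] at hx'
    linarith [le_max_left R₀ R₁]
  have hΩfar : Ω ⊆ I ×ˢ {x : EuclideanSpace ℝ (Fin 3) | R₀ < ‖x‖} :=
    prod_mono Subset.rfl fun x hx => hSfar x hx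
  -- ### the classical solution is a distributional solution on `Ω`
  obtain ⟨Q, hcl⟩ := exists_isClassicalNSSolutionOn_Iio hu
  have hΩsub : Ω ⊆ Iio (0 : ℝ) ×ˢ univ := prod_mono (fun t ht => ht.2) (subset_univ _)
  have hsol : IsDistributionalNSSolutionOn ⟨Ω, hΩo⟩ 1 0 u Q := by
    have hw2 : ContDiffOn ℝ 2 (uncurry u) (Iio (0 : ℝ) ×ˢ univ) :=
      hcl.smooth_velocity.of_le (by norm_cast)
    have hp1 : ContDiffOn ℝ 1 (uncurry Q) (Iio (0 : ℝ) ×ˢ univ) :=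
      hcl.smooth_pressure.of_le (by norm_cast)
    have hf : ContinuousOn
        (uncurry (0 : ℝ → EuclideanSpace ℝ (Fin 3) → EuclideanSpace ℝ (Fin 3)))
        (Iio (0 : ℝ) ×ˢ univ) := continuousOn_const
    refine isDistributionalNSSolutionOn_of_contDiffOn isOpen_Iio hΩsub hw2 hp1 hf
      (fun t ht x => ?_) hcl.divFree
    have hm := hcl.momentum t ht x
    rwa [timeDerivWithin_eq_deriv isOpen_Iio ht, ← timeDeriv_apply] at hm
  -- ### regularity inputs
  have hU4 : ∀ t ∈ I, ContDiffOn ℝ 4 (u t) S := fun t ht =>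
    ((hu.contDiff_slice ht.2).of_le (by norm_cast)).contDiffOn
  have hΦ : ∀ n ≤ 4, ContinuousOn
      (fun z : ℝ × EuclideanSpace ℝ (Fin 3) => iteratedFDeriv ℝ n (u z.1) z.2) Ω :=
    fun n _ => (hjc n).mono hΩfar
  have hK : ∀ n ≤ 4, ∀ z ∈ Ω, ‖iteratedFDeriv ℝ n (u z.1) z.2‖ ≤ K' := fun n hn z hz =>
    hbd n hn z.1 hz.1 z.2 (hSfar z.2 hz.2)
  -- ### the cut-off vorticity `ω' = σ • (∇ ∧ u)` and its weak vanishing at the top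
  obtain ⟨σ, hσs, hσ1, hσsupp, hσtest⟩ := exists_halfSpace_cutoff e R
  set ω' : ℝ → EuclideanSpace ℝ (Fin 3) → EuclideanSpace ℝ (Fin 3) :=
    fun t x => σ x • curl (u t) x with hω'def
  have hae : uncurry (vorticity u) =ᵐ[volume.restrict Ω] uncurry ω' := by
    refine (ae_restrict_mem hΩo.measurableSet).mono fun z hz => ?_
    show vorticity u z.1 z.2 = σ z.2 • curl (u z.1) z.2
    rw [vorticity_apply, hσ1 z.2 (le_of_lt hz.2), one_smul]
  have htop : ∀ φ : EuclideanSpace ℝ (Fin 3) → EuclideanSpace ℝ (Fin 3),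
      ContDiff ℝ (⊤ : ℕ∞) φ → HasCompactSupport φ → ∀ ε : ℝ, 0 < ε →
      ∃ s₀ : ℝ, s₀ < 0 ∧ ∀ᵐ s ∂(volume.restrict (Ioo s₀ 0)), |∫ y, ⟪ω' s y, φ y⟫| ≤ ε := by
    intro φ hφ hφc ε hε
    have hφt : FunctionSpaces.IsTestFunctionOn (⊤ : Opens (EuclideanSpace ℝ (Fin 3))) φ :=
      ⟨hφ, hφc, fun y _ => Opens.mem_top y⟩
    -- the test field `ψ = σ φ`, supported in `{⟪x, e⟫ > R - 1/2} ⊆ {⟪x, e⟫ > R₁}`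
    have hψ := hσtest φ hφt
    have hψsupp : ∀ x, σ x • φ x ≠ 0 → R₁ < ⟪x, e⟫ := fun x hx =>
      lt_of_le_of_lt hRR₁ (hσsupp x (left_ne_zero_of_smul hx))
    -- the identity `∫⟪ω'(s), φ⟫ = ∫⟪u(s), ∇ ∧ ψ⟫` for `s < 0`
    have hident : ∀ s < 0, ∫ y, ⟪ω' s y, φ y⟫ = ∫ y, ⟪u s y, curl (fun x => σ x • φ x) y⟫ := by
      intro s hs
      have h1 : (fun y => ⟪ω' s y, φ y⟫) = fun y => ⟪curl (u s) y, σ y • φ y⟫ := by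
        funext y
        show ⟪σ y • curl (u s) y, φ y⟫ = ⟪curl (u s) y, σ y • φ y⟫
        rw [real_inner_smul_left, real_inner_smul_right]
      rw [h1]
      exact integral_inner_curl_eq_integral_inner_curl
        ((hu.contDiff_slice hs).of_le (by exact_mod_cast le_top))
        (hψ.contDiff.of_le (by exact_mod_cast le_top)) hψ.hasCompactSupport
    -- the limit
    have hlim := hirr _ hψ hψsupp
    rw [Metric.tendsto_nhdsWithin_nhds] at hlim
    obtain ⟨δ, hδ, hδε⟩ := hlim ε hε
    refine ⟨-δ, by linarith, ?_⟩
    refine (ae_restrict_iff' measurableSet_Ioo).2 (ae_of_all _ fun s hs => ?_)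
    have hs0 : s < 0 := hs.2
    have hsd : dist s 0 < δ := by
      rw [Real.dist_eq, sub_zero, abs_of_neg hs0]; linarith [hs.1]
    have h3 := hδε hs0 hsd
    rw [Real.dist_eq, sub_zero] at h3
    rw [hident s hs0]
    exact h3.le
  -- ### ESŠ: the far-field vorticity vanishes on `{⟪x, e⟫ > R + 1}`
  have hzero := farField_curl_eq_zero_halfSpace_of_vorticity_top he htop hae hsol hU4 hΦ
    (fun n hn z hz => hK n (by omega) z hz)
  exact ⟨R + 1, fun t ht x hx => hzero (t, x) ⟨ht, hx⟩⟩

end Summit.NavierStokesRegularity.NavierStokesRegularity.Theorems.FiniteDissipationLiouville.Birth.Apex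

end
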